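import Literature.MathematicalPhysics.QuantumFieldTheory.Balaban1983to89.B8JunctionH59Vacuity
import Literature.MathematicalPhysics.QuantumFieldTheory.Balaban1983to89.B8IdxB8LawsB
import Literature.MathematicalPhysics.QuantumFieldTheory.Balaban1983to89.B8LeafModelZd3NonVacuity
import Literature.MathematicalPhysics.QuantumFieldTheory.Balaban1983to89.Node00.CarriersB8Cube

/-!
# `Balaban1983to89.B8SockB9P3CubeBinderVacuity` — KERNEL CERTIFICATE (consequence of the located corner defect): the «b9 socket AT EVERY CUBE of every
# law member» binder `SB9C` of the N05 record knits (`Summits/…/BalabanUVNodesN05AtRecord13SubBT8B9.lean` and its siblings: `∀ i, IdxB8LawsB L i →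
# ∀ c : CubeB8 d L i.k i.Ω, ∀ m ≤ c.k, SockB9P3 … (cubeFam false L c.a c.M c.ρ c.k) (cubeLamS …) (cubeLamB …)`) is UNSATISFIABLE (`d ≥ 2`, `L ≥ 1`,
# `B₀ > 0`, `cP > 0`) — the family of law members contains n05-a's `Ω_j = ℤᵈ` member, which carries cubes of (1.131), at which the all-levels socket is refuted

statement-level skeleton of published theorems with citation tags; proofs where landed; nothing here is a claim about the
Yang–Mills mass gap

`[Balaban1985RegularSpaces]` ("B8", CMP **99** (1985) 75–102) (1.58)–(1.59) p. 86, Thm 4 p. 88, Prop. 6 p. 99, (1.130)–(1.131) pp. 98–99, p. 77;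
[4] = `[Balaban1985BackgroundPropagators]` Thm 3.3 p. 399.  PDF held: `paper:balaban1985-cmp99-regular-spaces-gauge-fixing`.

CITATION HEADER (lean-in-tree rule).  Cell `pub-ymgap` (YM Track A, HUMAN RULING D-0062), DAG node N05 = [B8], seat `pub-ymgap-dag-n05-e` (g5;
director-ym R141 (C), FAN-OUT §N05 row s3b).  Fifth certificate of the located typing defect «(1.59) socket in the `SideTouches` currency at a FINITE
`Ω₀`».  BY NAME: n05-a's univ member (`B8LeafModelZd3NonVacuity.exists_member_univ`, `k = 1`, `η = L⁻¹`) obeys the four index laws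
(`B8IdxB8LawsB.idxB8LawsB_of_member_univ`) and carries the Proposition-6 cube `Node00.CubeB8.ofUniv` (`k = 1`, `a = 0`, `ρ = L`, `M = 11d + L + 1`);
the binder then asserts the all-levels socket `SockB9P3` at `cubeFam false L 0 M L 1`, refuted by `B8JunctionH59Vacuity.not_sockB9P3_allLevels_cubeMember`.
★ `not_sockB9P3_cubeBinder`.  CONSEQUENCE (count-neutral): every N05 face carrying `SB9C` (the record knits `…N05AtRecord13SubBT8B9` ∕ `…SubBT8`
∕ `…SubB`, the `…SubBKnit*` modules) has an unsatisfiable hypothesis as typed — vacuous until the socket family is re-typed (repair menu in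
`B8SockH59CornerDefect` ∕ the seat's desk note `CORNER-DEFECT-H59.md`: print's reading is `Ω₀ = T` for the Prop.-6 family).

HONEST SCOPE.  By-name composition into a negative typing certificate; nothing of [4] ∕ [Balaban1985RegularSpaces] proved or refuted (print consistent);
N05 NOT discharged; SECOND-GAP: none; one finite `T⁴` programme at fixed `ε`, Bałaban as printed; nothing continuum ∕ ℝ⁴ ∕ OS ∕ mass-gap ∕ Clay.  No
`sorry`, no `def`, no `instance`, no `notation`.  Unit `pub-ymgap-dag-n05-e` (g5), 2026-08-27.
-/

noncomputable section

namespace Literature.MathematicalPhysics.QuantumFieldTheory.Balaban1983to89.B8SockB9P3CubeBinderVacuity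

open NormedSpace
open B7Prop1Explicit B7Prop2Explicit
open B8LeafModelZd (ZdIdx)
open B8LeafModelZd3 (SockB9P3)
open B8LeafModelZd3NonVacuity (exists_member_univ)
open B8IdxB8LawsB (IdxB8LawsB idxB8LawsB_of_member_univ)
open B8Eq131CubesAdmissible (cubeFam)
open B8CubeMemberZd (cubeLamS cubeLamB)
open B8JunctionH59Vacuity (not_sockB9P3_allLevels_cubeMember)

export B7Prop1Explicit (Site)

variable {d : ℕ} {𝔸 : Type*} [CStarAlgebra 𝔸] [Nontrivial 𝔸]

/-- ★ **THE «b9 SOCKET AT EVERY CUBE OF EVERY LAW MEMBER» BINDER IS UNSATISFIABLE** (`d ≥ 2`, `L ≥ 1`, `B₀ > 0`, `cP > 0`; any `B₀β, β, len`): the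
hypothesis `SB9C` of the N05 record knits as typed.  Witness member: n05-a's `Ω_j = ℤᵈ` member at `k = 1`, `η = L⁻¹` with its cube `ofUniv 1 0 (11d+L+1) L`.
[cite: Balaban1985RegularSpaces, (1.58)–(1.59) p.86, Thm 4 p.88, Prop. 6 p.99, (1.130)–(1.131) pp.98–99; Balaban1985BackgroundPropagators, Thm 3.3 p.399] -/
theorem not_sockB9P3_cubeBinder (hd2 : 2 ≤ d) {L : ℕ} (hL : 1 ≤ L) {B₀ B₀β cP β : ℝ} {len : Site d → ℝ} (hB₀ : 0 < B₀) (hcP : 0 < cP) :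
    ¬ (∀ i : ZdIdx d L, IdxB8LawsB L i → ∀ c : Node00.CubeB8 d L i.k i.Ω, ∀ m, m ≤ c.k →
        SockB9P3 (𝔸 := 𝔸) L B₀ B₀β cP β len i.η m (cubeFam false L c.a c.M c.ρ c.k) (cubeLamS L c.a c.M c.ρ c.k)
          (cubeLamB L c.a c.M c.ρ c.k)) := by
  intro H
  have hL0 : (0 : ℝ) < L := by exact_mod_cast hL
  have hηpos : (0 : ℝ) < ((L : ℝ)⁻¹) ^ 1 := by positivity
  obtain ⟨i, hΩ0, hk, hη, hΩ, hΛ, hΛb⟩ := exists_member_univ (d := d) hL (le_refl 1) hηpos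
  have hlaws : IdxB8LawsB L i := idxB8LawsB_of_member_univ hL (by rw [hη, hk]) hΩ hΛ hΛb
  have hkK : 1 ≤ i.k := by rw [hk]
  have hΩ1 : i.Ω 1 = Set.univ := hΩ 1
  have hΩ0' : i.Ω (1 - 1) = Set.univ := hΩ _
  have hρM : L ≤ 11 * d + L + 1 := by omega
  have hbig : 11 * d < 11 * d + L + 1 := by omega
  have hLdM : L ≤ d * (11 * d + L + 1) := by nlinarith
  have h := H i hlaws (Node00.CubeB8.ofUniv 1 (0 : Site d) (11 * d + L + 1) L le_rfl hkK le_rfl hρM hbig hLdM hΩ1 hΩ0')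
  have hiη : 0 < i.η := by rw [hη]; exact hηpos
  exact not_sockB9P3_allLevels_cubeMember hd2 hL hiη (0 : Site d) (11 * d + L + 1) (le_refl L) (le_refl 1) hB₀ hcP
    (fun m hm => h m hm)

#print axioms not_sockB9P3_cubeBinder

end Literature.MathematicalPhysics.QuantumFieldTheory.Balaban1983to89.B8SockB9P3CubeBinderVacuity

end
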